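import Mathlib
import HarnessLib
import HarnessLib.Audit
import Summits.NavierStokesRegularity.Statement
import Literature.Analysis.FluidPDE.ClassicalSolution
import Literature.Analysis.FluidPDE.LerayHopf
import Literature.Analysis.FluidPDE.NSWave0
import Literature.Analysis.FluidPDE.VectorCalculus
import Literature.Analysis.FluidPDE.SuitableWeak
import Literature.Analysis.FluidPDE.NSCriticalClosureBesovKatoClass
import Summits.NavierStokesRegularity.NavierStokesRegularity.Theorems.NoBlowupToClay
import HarnessLib.Audit.Status.Attr

/-!
Route: QuarterJolt

DORMANT since 2026-08-28T18:34:00Z (superseded modulo residual EQL by p655816: NoTerminalJolt <-> NoTypeIBlowup (1217) under EnstrophyQuarterLaw; banked p629148 p629677 p644649 p645113 p645273 p655816; reactivate only on a BC5 witness s) — unstaffed, not closed; items shared with open routes are served there. `ledger route dormant <id> --off` reactivates.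

# Route QuarterJolt — no terminal jolt — a quarter-law blow-up must approach u(T) in L² at the
self-similar rate; EQL ∧ NoTerminalJolt decide Clay (A)

It suffices to show X = X1 ∧ X2 with X1 = EnstrophyQuarterLaw (the eI-shelf statement
stmt-NavierStokesRegularity-1574, shared
verbatim: a finite-energy first blow-up carries enstrophy at most K(T−t)^(−1/2)) and X2 =
NoTerminalJolt (NEW, lens wuc): in the frame
(classical on [0,T), Leray–Hopf on [0,T], rapidly decaying datum) the energy-norm distance to the
terminal state u(T) — pinned by the
Leray–Hopf weak continuity — is o((T−t)^(1/4)): (T−t)^(−1/2)·‖u(t)−u(T)‖₂² → 0 as t ↑ T. Both parts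
are consequences of S (no blow-up ⇒ X1
vacuous, u smooth across T ⇒ ‖u(t)−u(T)‖₂ = O(T−t)); X2 is the first member of the family
‖u(t)−u(T)‖₂ = O((T−t)^α) beyond the edge α = 1/4
that X1 itself yields. They are USED toward S through two provable-now supports: JoltFlatCell (X1 ⇒
record-time Type I, and two triangle
inequalities through u(T) make the scaled kinetic energy of every parabolic cell vanish) and
NoFlatCellVertex (a vanishing cell plus the
slice law forces cknC → 0, and the tree's top-point ε-regularity criterion bounds u near the
vertex). No summit is proved by this line; it
files a closer whose by-product is the terminal jolt law: a quarter-law blow-up has limsup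
(T−t)^(−1/4)‖u(t)−u(T)‖₂ > 0.
Lean: `(∀ (ν T : ℝ), 0 < ν → 0 < T → ∀ (u : ℝ → EuclideanSpace ℝ (Fin 3) → EuclideanSpace ℝ (Fin 3))
(p : ℝ → EuclideanSpace ℝ (Fin 3) → ℝ), Literature.Analysis.FluidPDE.IsMaximalSmoothSolution ν 0 u p
T → Literature.Analysis.FluidPDE.IsLerayHopfOn T ν 0 (u 0) u →
Literature.Analysis.FluidPDE.HasRapidSpatialDecay (u 0) → ∃ K : ℝ, ∀ t ∈ Set.Ico 0 T, ∫⁻ x,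
‖Literature.Analysis.FluidPDE.curl (u t) x‖ₑ ^ 2 ≤ ENNReal.ofReal (K / Real.sqrt (T - t))) ∧ (∀ (ν T
: ℝ), 0 < ν → 0 < T → ∀ (u : ℝ → EuclideanSpace ℝ (Fin 3) → EuclideanSpace ℝ (Fin 3)) (p : ℝ →
EuclideanSpace ℝ (Fin 3) → ℝ), Literature.Analysis.FluidPDE.IsClassicalNSSolutionOn (Set.Ico 0 T) ν
0 u p → Literature.Analysis.FluidPDE.IsLerayHopfOn T ν 0 (u 0) u →
Literature.Analysis.FluidPDE.HasRapidSpatialDecay (u 0) → Filter.Tendsto (fun t : ℝ => (Real.sqrt (T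
- t))⁻¹ * ∫ x, ‖u t x - u T x‖ ^ 2) (nhdsWithin T (Set.Iio T)) (nhds 0))`

## Assembly
Pure logic over the frame theorem `Theorems.navierStokesRegularity_of_noBlowup` (NoBlowup → Clay
(A), proved): given a classical Leray–Hopf solution on [0,T) with no smooth extension, X1 gives the
constant K, `exists_singularPoint_of_classical_of_not_hasSmoothExtensionPast` (ε-regularity
contrapositive, Literature) gives a singular vertex x₀, X2 with JoltFlatCell gives the vanishing
cell at x₀, and NoFlatCellVertex refutes the singular vertex. The deciding theorem `closes` in
glue.lean is kernel-checked (Sketch.lean rc 0, 0 sorry).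

Rationale: WHY THIS LINE. Mechanism: a TEMPORAL approach rate replaces the spatial terminal-trace density of
TerminalTrace/QuarterBudgetTrace — under the record-time Type-I bound ‖u(t)‖_∞ ≤ C(T−t)^(−1/2) that
X1 gives (RecordTimeTypeI, proved in Theorems/LerayQuarterDissipationRecordTimeTypeI),
∫_(B_r(x₀))|u(T)|² ≤ 2‖u(T)−u(T−θr²)‖₂² + 2|B_r|C²/(θr²) and ∫_(B_r)|u(t)|² ≤ 2‖u(t)−u(T)‖₂² +
2∫_(B_r)|u(T)|², so o((T−t)^(1/4)) approach makes the CKN scaled energy A(r) → 0 at every point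
(even uniformly in x₀), and A → 0 with Sobolev L⁶ slices gives cknC(r) ≤ cK^(3/4)A(r)^(3/4) → 0, the
hypothesis of the tree's criterion `exists_bound_near_top_of_classical_of_tendsto_cknC`
(GustafsonKangTsai2007 Thm 1.1 / CKN1982) with the apex package
`isSuitableWeakSolutionInBall_apex_of_classical` (AlbrittonBarker2019 class, SereginSverak2002
gauge). Imported area: parabolic ε-regularity and Morrey/Campanato flatness; the literature
neighbour is LeslieShvydkoy2017 (arXiv:1705.04420) Thm 1.2 — Type-I in time ⇒ A(r,x₀) ≤ C (Type-I in
space) ⇒ energy equality at the first blow-up time, i.e. ‖u(t)−u(T)‖₂ → 0; the line asks for the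
RATE and shows that one notch past the self-similar rate already forces regularity. What no listed
route does: every eI-shelf route closes through a Liouville residual (NoLocalTypeISingularity 10480
/ FirstTimeDissipativeLiouville 22144 / ParabolicGaldiLiouville 0893) and
TerminalTrace/QuarterBudgetTrace through a fixed-time trace density plus the open LOUD core or
budget packing; here the residual is a one-line temporal law on all of ℝ³ with no base point, and
the bridge is classical ε-regularity only (no blow-up zoom, no Carleman, no packing) — it is the
cheapest typed closer on shelf 1574. Honest relation: given X1, X2 ⇒ A → 0 ⇒ NoTraceConcentration,
so X2 is stronger than TerminalTrace's crux B; the price buys a bridge that is provable now in two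
M-sized supports. Negatives index (OddMorawetzLocal, FiniteTangentModuli, PerpetualPump thesis,
CorrectorSolvable, ClayNonuniqueness) untouched. DISTANCE LABEL (idea-crit-8 VERDICT on LINE 5,
07:16Z, price P1, verbatim): «Clay ⇐ EQL ∧ NTJ, both open-XL consequences of S; NTJ ⟺_EQL no-blow-up
via M-size ε-regularity; deliverable = the Type-I TERMINAL JOLT LAW, sibling of LINE 4's scar law;
zero width on EQL/NTJ» — i.e. modulo the shelf crux EQL (⇒ Type I, landed
lerayQuarterDissipation_recordTimeTypeI_proof) NTJ is equivalent to no-blow-up by this route's own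
two M-size supports (the TIME face of the Type-I concentration fact whose SPACE face is LINE 4 /
QuarterBudgetTrace); the route is advertised as that conditional theorem, never as progress on EQL
or NTJ.

RANKED CRUXES. #2 EnstrophyQuarterLaw (crux) — shelf statement stmt-NavierStokesRegularity-1574
verbatim (eI quarter law): a finite-energy classical solution from a rapidly decaying datum, maximal
at T, has ∫‖curl u(t)‖² ≤ K(T−t)^(−1/2) on [0,T). [difficulty: open-problem] (why it might fail:
says every finite-energy blow-up is Type I in enstrophy (Leray's lower rate is sharp); no upper
bound on any NS blow-up rate is known, and with Seregin2020 (axisymmetric singular points are Type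
II) one singular axisymmetric flow (Hou2022 numerics) kills it.) [Leray1934, Seregin2020,
Hou2022PotentiallySingularNS, Tao2021QuantitativeNS, arXiv:2107.06509]
#3 NoTerminalJolt (crux) — NO TERMINAL JOLT (new, wuc): in the frame (classical on [0,T), Leray–Hopf
on [0,T], rapidly decaying datum) the L² distance to the terminal state is o((T−t)^(1/4)):
(T−t)^(−1/2)·∫|u(t,x)−u(T,x)|²dx → 0 as t ↑ T. u(T) is the Leray–Hopf value (weakly continuous, in
L²), so there is no junk; for a flow smooth across T the quantity is O((T−t)^(3/2)). [difficulty: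
open-problem] (why it might fail: a-priori rate claim at the critical scaling; any blow-up
approaching u(T) at the self-similar rate (every λ-DSS profile differing from its homogeneous
tangent: (T−t)^(−1/2)‖u(t)−u(T)‖²_(L²(B₁)) → ‖U−U_hom‖²>0; Hou2022 numerics) kills it; Type I alone
gives only O((T−t)^(1/4)).) [LeslieShvydkoy2017, arXiv:1705.04420, GustafsonKangTsai2007,
Hou2022PotentiallySingularNS, BarkerPrange2021]
#9 JoltFlatCell (support) — JOLT-FLAT CELL (provable-now, M−): in the frame, the slice law with
constant K and no terminal jolt give, at EVERY x₀, a vanishing scaled cell energy: ∀ε>0 ∃r₀>0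
∀r∈(0,r₀) ∀t∈(T−r²,T]: ∫_(B_r(x₀))|u(t)|² ≤ εr. Proof plan:
`lerayQuarterDissipation_recordTimeTypeI_proof` (RecordTimeTypeI, proved) gives IsTypeIBlowup u T,
i.e. ‖u(t,x)‖ ≤ C(T−t)^(−1/2) for t in some (T₁,T); then ∫_(B_r)|u(T)|² ≤ 2‖u(T)−u(T−θr²)‖₂² +
(8π/3)C²r/θ with θ large, and ∫_(B_r)|u(t)|² ≤ 2‖u(t)−u(T)‖₂² + 2∫_(B_r)|u(T)|² ≤ 2D(t)r +
2∫_(B_r)|u(T)|² for t∈(T−r²,T); choose θ then r₀ (θr₀² < T−T₁, sup D small). u(t), u(T) ∈ L² by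
IsLerayHopfOn.memLp. [difficulty: provable-now] [LeslieShvydkoy2017, CKN1982]
#9 NoFlatCellVertex (support) — NO FLAT-CELL VERTEX (provable-now, M): in the frame with the slice
law, a point x₀ whose scaled cell energy vanishes (the JoltFlatCell conclusion) is not a singular
vertex: ¬(u essentially unbounded on every Q_r(T,x₀), r²<T). Proof plan: Sobolev Ḣ¹⊂L⁶ on slices
(‖u(t)‖₆ ≤ cZ(t)^(1/2) ≤ cK^(1/2)(T−t)^(−1/4)) and Hölder on balls give ∫_(T−r²)^T∫_(B_r)|u|³ ≤ c(A
r)^(3/4)K^(3/4)r^(5/4), i.e. cknC(r) ≤ cK^(3/4)A(r)^(3/4) → 0; rescale ν to 1 (nsRescale) and apply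
`exists_bound_near_top_of_classical_of_tendsto_cknC` (ClassicalTopPointCubic) with the
gauged-pressure apex package `isSuitableWeakSolutionInBall_apex_of_classical`
(BesovBlowupConcentration; ∇u ∈ L²(Q_ρ) from the slice law, sup_t∫_(B_ρ)|u|² from the energy bound,
pressure ∈ L^(3/2) by the gauge), giving ‖u‖ ≤ M on some Q_r(T,x₀), which contradicts eLpNorm = ⊤ on
Q_(min(r,√(T/2))). (GustafsonKangTsai2007 Thm 1.1 with (p,q)=(2,∞) gives it even without the slice
law.) [difficulty: provable-now] [GustafsonKangTsai2007, CKN1982, AlbrittonBarker2019,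
SereginSverak2002] STAFFING (price P2): NO separate seat — the supports of LINE 4
(QuarterBudgetTrace: 26015 NoBudgetedExtinctApex → 26014 BudgetedExtinctApex, first per KEY-NS #72)
and of this line (26465 NoFlatCellVertex → 26464 JoltFlatCell) are ONE unit for ONE prover (same
toolkit: Type I from EQL, cell energies, ε-regularity contrapositive), in that order, each
announce-before-WRITE. BC5 (price P3): the rung noTerminalJolt_ssCaricature_iff is proposed as
Theorems/QuarterJoltRung.lean (p611876, --supports 26463).

TWO-LAYER PLAN. JoltFlatCell ⇐ TypeIFromSlice (= RecordTimeTypeI, proved) → TwoTriangleCell (the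
displayed estimate) → JoltFlatCell. NoFlatCellVertex ⇐ CubicFromFlatCell (cknC ≤ cK^(3/4)A^(3/4),
Sobolev slices) → TopPointCriterionNu (ν-rescaled
`exists_bound_near_top_of_classical_of_tendsto_cknC` with the apex pressure gauge) →
NoFlatCellVertex. Nothing filed now.

KILL CRITERIA. Refutation of EnstrophyQuarterLaw (a finite-energy Type-II enstrophy burst) closes
the route `refuted:EnstrophyQuarterLaw` with the whole eI shelf; refutation of NoTerminalJolt (a
blow-up approaching u(T) at the self-similar L² rate, e.g. a rigorous DSS blow-up with
non-homogeneous profile) closes it `refuted:NoTerminalJolt` — and then the two supports still yield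
the unconditional-in-form jolt theorem as a Theorems by-product. A refutation of a SUPPORT as typed
(quantifier slip at t = T or r₀ > √T) forces a restatement, not a pivot. NoLocalTypeISingularity
(10480) proved elsewhere moots the line.

NOT DECOMPOSED YET. The ν-rescaling of the top-point criterion, the lintegral/Bochner conversions,
the choice r₀ ≤ √T, and the L⁶-slice inequality with its constant are layer-2 children of the
supports; X1 is a shared item with its own programme (skeleton of record Lines/sparse_sieve.lean,
Lines/window_average.lean) and X2 ships the birth skeleton bc/NoTerminalJolt_birth.lean (published
as Lines/birth.lean after open): NoTerminalJolt_of : stub_joltLiminf (along SOME tₙ ↑ T the jolt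
functional D(tₙ) → 0 — the blow-up-excluding half, false for the self-similar caricature) →
stub_joltLimit (D has a one-sided limit at T — the half excluding DSS-type log-periodic modulation)
→ NoTerminalJolt (kernel-checked, sorries only in the two stubs); the O((T−t)^(1/4)) upper law under
X1 (Numbers) is the plan-only first prover target on the X2 side.

CHEAPEST FALSIFIER. The kinematic self-similar caricature u(t,x) = λU(λx), λ = (T−t)^(−1/2), extinct
trace: (T−t)^(−1/2)‖u(t)−0‖₂² ≡ ‖U‖₂² (proved, bc/NoTerminalJolt_rung.lean) — so X2 is exactly the
exclusion of self-similar-rate L² approach, neither vacuous nor implied by Type I; the cheapest kill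
of X2 is therefore any rigorous DSS/Type-I blow-up whose profile is not its homogeneous tangent
(instrument row: pub-ns-dss profile searches). The cheapest kill of the BRIDGE is the hand check
(done) that JoltFlatCell needs the Type-I bound at ONE earlier time T−θr² only and that t = T is
covered by the first triangle inequality.

NUMBERS. Edge of the family under X1: ‖u(t)−u(T)‖₂ ≤ C(K,ν,C_I)(T−t)^(1/4) from ‖P(u·∇u)‖₂ ≤
‖u‖_∞Z^(1/2) ≤ C_I K^(1/2)(T−t)^(−3/4) and the dyadic H² energy estimate ν∫_(T−2τ)^(T−τ)‖Δu‖₂² ≤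
Z(T−2τ) + ν^(−1)∫‖u‖²_∞Z ≲ τ^(−1/2) (so ∫_t^T‖Δu‖₂ ≲ Στ_j^(1/4)); cell constant: ∫_(B_r)|u(T)|² ≤
(2√θ·D(T−θr²) + (8π/3)C²/θ)·r; cubic bound cknC(r) ≤ c·(8/5)K^(3/4)A(r)^(3/4).

DEFINITION REQUESTS. None: every notion is an existing declaration (IsClassicalNSSolutionOn,
IsMaximalSmoothSolution, IsLerayHopfOn, HasRapidSpatialDecay, curl, parabolicCylinder, eLpNorm,
Metric.ball, nhdsWithin).

Novelty: Searches (2026-08-28): lit search --hybrid "energy equality first blow-up time Navier-Stokes Type I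
Leslie Shvydkoy" (10 books, generic); lit search --source all "energy measure Euler Navier-Stokes
equations blowup time energy equality Type I" (local: paper:arxiv-1705.04420 LeslieShvydkoy2017
pp.2,4,14; remote: doi:10.1007/s00205-018-1250-4, Cheskidov–Luo doi:10.1088/1361-6544/ab60d3); lit
read paper:arxiv-1705.04420 --grep 'Type.?I|rate|(T-t)' (44 hits: Thm 1.2 p.5, "Type-I in time ⇒
Type-I in space" p.14 — no statement on the rate of ‖u(t)−u(T)‖₂); lit vsearch "rate of convergence
of u(t) to u(T) in L2 at blow-up, Type I, Hölder 1/4" (papers: 0 docs; all: Seregin2014 notes p.131,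
RRS2016 pp.118,137 = lower bounds on blow-up of ‖u‖_(H^s), not distance to u(T)); lit galaxy search
"Type-I in space|energy measure|concentration dimension of the energy" --star all (36 rows, 0
mathematical); tree: Theses of the sub (TerminalTrace 18614/18615 use the fixed-time trace and a
BOUNDED Morrey cell; HodographBetchov №6 NoFastEnergyConcentration 18118 = uniform integrability, no
rate; FastClassSqueeze = Morrey-bounded energy), ledger negatives (5 entries, unrelated).
Nearest prior art found: LeslieShvydkoy2017 (arXiv:1705.04420) Thm 1.2 + Prop. p.14 (Type-I ⇒
A(r,x₀) ≤ C ⇒ energy equality at T, hence ‖u(t)−u(T)‖₂ → 0: the α = 0 member); GustafsonKangTsai2007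
Thm 1.1 case (p,q)=(2,∞) (A small at all scales ⇒ regular); in the tree stmt-18615
MorreyCellCriterion (A bounded + flat trace ⇒ bou  [refs: 10.1007/s00205-018-1250-4, 10.1088/1361-6544/ab60d3, 1705.04420, paper:arxiv-1705.04420, doi:10.1007/s00205-018-1250-4, doi:10.1088/1361-6544/ab60d3, LeslieShvydkoy2017, Seregin2014, GustafsonKangTsai2007]

Barriers (technique_class: epsilon-regularity, blowup-rate, morrey-flatness): - technique_class: epsilon-regularity, blowup-rate, morrey-flatness
- Literature.Barriers.NavierStokesRegularity.EnergySupercriticality: X1 and X2 are a-priori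
critical-scaling claims and sit inside the class the heuristic warns about; the route does not claim
to prove them by energy methods — they are wuc residuals (consequences of S used toward S); the
supports live on the known side (Type-I sup bound + ε-regularity).
- Literature.Barriers.NavierStokesRegularity.TaoAveragedBlowup: the supports are generic parabolic
ε-regularity, so the barrier is honoured, not beaten: everything equation-specific is concentrated
in the cruxes X1, X2, whose proofs must use the fine structure of the nonlinearity; for Tao's
averaged cascade X2's analogue fails (self-similar-rate transfer), consistent with the jolt law.
- Literature.Barriers.NavierStokesRegularity.AveragedTypeIBlowup: a Type-I blow-up exists for an
averaged NS with energy identity, so Type I cannot be excluded by energy-level arguments; the line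
excludes only Type-I blow-ups WITH o((T−t)^(1/4)) terminal approach, and predicts that the averaged
blow-up jolts — X2 is where the true equation must enter.
- Literature.Barriers.NavierStokesRegularity.NavierStokesInequalitySingularSolution: Scheffer's
singular solution of the Navier–Stokes INEQUALITY is an exactly self-similar Type-I cascade: its
cell energy A(r) does not vanish and its local terminal approach is at the self-similar rate, so it
violates the hypotheses of both supports

History (route lifecycle, newest last):
- 2026-08-28T18:34:00Z · DORMANT — superseded modulo residual EQL by p655816: NoTerminalJolt <-> NoTypeIBlowup (1217) under EnstrophyQuarterLaw; banked p629148 p629677 p644649 p645113 p645273 p65 (operator:999:2869970)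

sub-problem: NavierStokesRegularity · status: dormant · opened planner-ns-idea-9-g2-0 2026-08-28T07:09:38Z · rev 1 · ledger route-NavierStokesRegularity-QuarterJolt
GENERATED by the gate from the ledger (D-0016/17). Provers cite these decls: `theorem foo : Summit.NavierStokesRegularity.NavierStokesRegularity.Theses.QuarterJolt.<Decl> := …` in Summits/NavierStokesRegularity/NavierStokesRegularity/Theorems/<Name>.lean.
-/

namespace Summit.NavierStokesRegularity.NavierStokesRegularity.Theses.QuarterJolt

open scoped BigOperators Topology Manifold Classical MeasureTheory ProbabilityTheory Matrix InnerProductSpace ComplexConjugate ContinuousMap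
open Filter Set Function TopologicalSpace MeasureTheory

attribute [summit_statement] _root_.NavierStokesRegularity

open Literature.NS

/-- item stmt-NavierStokesRegularity-1574 · crux · rank 2 · open · by planner
why it might fail: says every finite-energy blow-up is Type I in enstrophy (Leray's lower rate is sharp); no upper bound on any NS blow-up rate is known, and with Seregin2020 (axisymmetric singular points are Type II) one singular axisymmetric flow (Hou2022 numerics) kills it.
sources: Leray1934, Seregin2020, Hou2022PotentiallySingularNS, Tao2021QuantitativeNS, arXiv:2107.06509
[crux] QUARTER LAW / enstrophy at Leray's rate (card F6; absorbs leray-quanta-energy-modulus X_H).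
If a finite-energy classical solution from a rapidly decaying datum is maximal at T<oo, then
Omega(t) = int |curl u(t)|^2 <= K (T-t)^{-1/2} on [0,T) for some K (lintegral form: infinite
enstrophy violates it). Leray1934 sec.19-22 gives the matching LOWER bound Omega >= c
nu^{3/2}(T-t)^{-1/2} (in tree: leray_blowup_rate_top family), so the claim is 'dissipation blows up
at exactly Leray's rate'. Spectral form (the card's thesis object): with alpha = xi.(grad u)xi and
Lambda(t) = sup_psi (int alpha_+|psi|^2 - nu int|grad psi|^2)/int|psi|^2 = sup spec(nu Lap +
alpha_+), one has d/dt log Omega <= 2 Lambda, blow-up forces int_{t0}^t Lambda >= (1/4) log(1/(T-t))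
- C, and the crux is equivalent to int_{t0}^t (Lambda_eff - 1/(4(T-s))) ds = O(1) with Lambda_eff :=
(1/2) d/dt log Omega <= Lambda: 'Type II <=> the stretching well binds more than a quarter per unit
log-time'. Consequences (not filed): E(Q(z,r)) = r^{-1} intint_Q |grad u|^2 <= 2K/nu-scaled for
EVERY parabolic ball below T (uniform rescaled-energy Type I => TypeIBridge); expected, to be
checked (leray-quanta graft): finitely many s -/
@[route_item "route-NavierStokesRegularity-QuarterJolt", crux]
def EnstrophyQuarterLaw : Prop :=
  ∀ (ν T : ℝ), 0 < ν → 0 < T → ∀ (u : ℝ → EuclideanSpace ℝ (Fin 3) → EuclideanSpace ℝ (Fin 3)) (p : ℝ → EuclideanSpace ℝ (Fin 3) → ℝ), Literature.Analysis.FluidPDE.IsMaximalSmoothSolution ν 0 u p T → Literature.Analysis.FluidPDE.IsLerayHopfOn T ν 0 (u 0) u → Literature.Analysis.FluidPDE.HasRapidSpatialDecay (u 0) → ∃ K : ℝ, ∀ t ∈ Set.Ico 0 T, ∫⁻ x, ‖Literature.Analysis.FluidPDE.curl (u t) x‖ₑ ^ 2 ≤ ENNReal.ofReal (K / Real.sqrt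 (T - t))

/-- item stmt-NavierStokesRegularity-26463 · crux · rank 3 · open · by planner
why it might fail: a-priori rate claim at the critical scaling; any blow-up approaching u(T) at the self-similar rate (every λ-DSS profile differing from its homogeneous tangent: (T−t)^(−1/2)‖u(t)−u(T)‖²_(L²(B₁)) → ‖U−U_hom‖²>0; Hou2022 numerics) kills it; Type I alone gives only O((T−t)^(1/4)).
sources: LeslieShvydkoy2017, arXiv:1705.04420, GustafsonKangTsai2007, Hou2022PotentiallySingularNS, BarkerPrange2021
[crux] NO TERMINAL JOLT (new, wuc): in the frame (classical on [0,T), Leray–Hopf on [0,T], rapidly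
decaying datum) the L² distance to the terminal state is o((T−t)^(1/4)):
(T−t)^(−1/2)·∫|u(t,x)−u(T,x)|²dx → 0 as t ↑ T. u(T) is the Leray–Hopf value (weakly continuous, in
L²), so there is no junk; for a flow smooth across T the quantity is O((T−t)^(3/2)). [difficulty:
open-problem] -/
@[route_item "route-NavierStokesRegularity-QuarterJolt", crux]
def NoTerminalJolt : Prop :=
  ∀ (ν T : ℝ), 0 < ν → 0 < T → ∀ (u : ℝ → EuclideanSpace ℝ (Fin 3) → EuclideanSpace ℝ (Fin 3)) (p : ℝ → EuclideanSpace ℝ (Fin 3) → ℝ), Literature.Analysis.FluidPDE.IsClassicalNSSolutionOn (Set.Ico 0 T) ν 0 u p → Literature.Analysis.FluidPDE.IsLerayHopfOn T ν 0 (u 0) u → Literature.Analysis.FluidPDE.HasRapidSpatialDecay (u 0) → Filter.Tendsto (fun t : ℝ => (Real.sqrt (T - t))⁻¹ * ∫ x, ‖u t x - u T x‖ ^ 2) (nhdsWithin T (Set.Iio T)) (nhds 0)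

/-- item stmt-NavierStokesRegularity-26464 · support · rank 9 · closed · proved by Summit.NavierStokesRegularity.NavierStokesRegularity.Theorems.joltFlatCell_proof (prover) · by planner
sources: LeslieShvydkoy2017, CKN1982
[support] JOLT-FLAT CELL (provable-now, M−): in the frame, the slice law with constant K and no
terminal jolt give, at EVERY x₀, a vanishing scaled cell energy: ∀ε>0 ∃r₀>0 ∀r∈(0,r₀) ∀t∈(T−r²,T]:
∫_(B_r(x₀))|u(t)|² ≤ εr. Proof plan: `lerayQuarterDissipation_recordTimeTypeI_proof`
(RecordTimeTypeI, proved) gives IsTypeIBlowup u T, i.e. ‖u(t,x)‖ ≤ C(T−t)^(−1/2) for t in some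
(T₁,T); then ∫_(B_r)|u(T)|² ≤ 2‖u(T)−u(T−θr²)‖₂² + (8π/3)C²r/θ with θ large, and ∫_(B_r)|u(t)|² ≤
2‖u(t)−u(T)‖₂² + 2∫_(B_r)|u(T)|² ≤ 2D(t)r + 2∫_(B_r)|u(T)|² for t∈(T−r²,T); choose θ then r₀ (θr₀² <
T−T₁, sup D small). u(t), u(T) ∈ L² by IsLerayHopfOn.memLp. [difficulty: provable-now] -/
@[route_item "route-NavierStokesRegularity-QuarterJolt", crux]
def JoltFlatCell : Prop :=
  ∀ (ν T : ℝ), 0 < ν → 0 < T → ∀ (u : ℝ → EuclideanSpace ℝ (Fin 3) → EuclideanSpace ℝ (Fin 3)) (p : ℝ → EuclideanSpace ℝ (Fin 3) → ℝ), Literature.Analysis.FluidPDE.IsClassicalNSSolutionOn (Set.Ico 0 T) ν 0 u p → Literature.Analysis.FluidPDE.IsLerayHopfOn T ν 0 (u 0) u → Literature.Analysis.FluidPDE.HasRapidSpatialDecay (u 0) → ∀ K : ℝ, (∀ t ∈ Set.Ico 0 T, ∫⁻ x, ‖Literature.Analysis.FluidPDE.curl (u t) x‖ₑ ^ 2 ≤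 ENNReal.ofReal (K / Real.sqrt (T - t))) → Filter.Tendsto (fun t : ℝ => (Real.sqrt (T - t))⁻¹ * ∫ x, ‖u t x - u T x‖ ^ 2) (nhdsWithin T (Set.Iio T)) (nhds 0) → ∀ x₀ : EuclideanSpace ℝ (Fin 3), ∀ ε : ℝ, 0 < ε → ∃ r₀ : ℝ, 0 < r₀ ∧ ∀ r : ℝ, 0 < r → r < r₀ → ∀ t ∈ Set.Ioc (T - r ^ 2) T, ∫⁻ x in Metric.ball x₀ r, ‖u t x‖ₑ ^ 2 ≤ ENNReal.ofReal (ε * r)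

-- `JoltFlatCell` holds: proved by `Summit.NavierStokesRegularity.NavierStokesRegularity.Theorems.joltFlatCell_proof` (its module imports this route file, so no `_holds` link can be stated here).

/-- item stmt-NavierStokesRegularity-26465 · support · rank 9 · closed · proved by Summit.NavierStokesRegularity.NavierStokesRegularity.Theorems.noFlatCellVertex_proof (prover) · by planner
sources: GustafsonKangTsai2007, CKN1982, AlbrittonBarker2019, SereginSverak2002
[support] NO FLAT-CELL VERTEX (provable-now, M): in the frame with the slice law, a point x₀ whose
scaled cell energy vanishes (the JoltFlatCell conclusion) is not a singular vertex: ¬(u essentially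
unbounded on every Q_r(T,x₀), r²<T). Proof plan: Sobolev Ḣ¹⊂L⁶ on slices (‖u(t)‖₆ ≤ cZ(t)^(1/2) ≤
cK^(1/2)(T−t)^(−1/4)) and Hölder on balls give ∫_(T−r²)^T∫_(B_r)|u|³ ≤ c(A r)^(3/4)K^(3/4)r^(5/4),
i.e. cknC(r) ≤ cK^(3/4)A(r)^(3/4) → 0; rescale ν to 1 (nsRescale) and apply
`exists_bound_near_top_of_classical_of_tendsto_cknC` (ClassicalTopPointCubic) with the
gauged-pressure apex package `isSuitableWeakSolutionInBall_apex_of_classical`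
(BesovBlowupConcentration; ∇u ∈ L²(Q_ρ) from the slice law, sup_t∫_(B_ρ)|u|² from the energy bound,
pressure ∈ L^(3/2) by the gauge), giving ‖u‖ ≤ M on some Q_r(T,x₀), which contradicts eLpNorm = ⊤ on
Q_(min(r,√(T/2))). (GustafsonKangTsai2007 Thm 1.1 with (p,q)=(2,∞) gives it even without the slice
law.) [difficulty: provable-now] -/
@[route_item "route-NavierStokesRegularity-QuarterJolt", crux]
def NoFlatCellVertex : Prop :=
  ∀ (ν T : ℝ), 0 < ν → 0 < T → ∀ (u : ℝ → EuclideanSpace ℝ (Fin 3) → EuclideanSpace ℝ (Fin 3)) (p : ℝ → EuclideanSpace ℝ (Fin 3) → ℝ), Literature.Analysis.FluidPDE.IsClassicalNSSolutionOn (Set.Ico 0 T) ν 0 u p → Literature.Analysis.FluidPDE.IsLerayHopfOn T ν 0 (u 0) u → Literature.Analysis.FluidPDE.HasRapidSpatialDecay (u 0) → ∀ K : ℝ, (∀ t ∈ Set.Ico 0 T, ∫⁻ x, ‖Literature.Analysis.FluidPDE.curl (u t) x‖ₑ ^ 2 ≤ ENNReal.ofReal (K / Real.sqrt (T - t))) →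 ∀ x₀ : EuclideanSpace ℝ (Fin 3), (∀ ε : ℝ, 0 < ε → ∃ r₀ : ℝ, 0 < r₀ ∧ ∀ r : ℝ, 0 < r → r < r₀ → ∀ t ∈ Set.Ioc (T - r ^ 2) T, ∫⁻ x in Metric.ball x₀ r, ‖u t x‖ₑ ^ 2 ≤ ENNReal.ofReal (ε * r)) → ¬ (∀ r : ℝ, 0 < r → r ^ 2 < T → MeasureTheory.eLpNorm (Function.uncurry u) ⊤ (MeasureTheory.volume.restrict (Literature.Analysis.FluidPDE.parabolicCylinder r ((T : ℝ), x₀))) = ⊤)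

-- `NoFlatCellVertex` holds: proved by `Summit.NavierStokesRegularity.NavierStokesRegularity.Theorems.noFlatCellVertex_proof` (its module imports this route file, so no `_holds` link can be stated here).

/-- item stmt-NavierStokesRegularity-26466 · assembly · rank 1 · closed · proved by Summit.NavierStokesRegularity.NavierStokesRegularity.Theorems.quarterJolt_assembly_proof (prover) · by planner
sources: Fefferman2000, CKN1982, GustafsonKangTsai2007
[assembly] EnstrophyQuarterLaw → NoTerminalJolt → JoltFlatCell → NoFlatCellVertex → Clay (A). -/
@[route_item "route-NavierStokesRegularity-QuarterJolt"]
def Assembly : Prop :=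
  EnstrophyQuarterLaw → NoTerminalJolt → JoltFlatCell → NoFlatCellVertex → NavierStokesRegularity

-- `Assembly` holds: proved by `Summit.NavierStokesRegularity.NavierStokesRegularity.Theorems.quarterJolt_assembly_proof` (its module imports this route file, so no `_holds` link can be stated here).

/-! D-0027 §2.1 — DECIDING THEOREM (planner-authored via `route open/edit --closes-file`; by planner-ns-idea-9-g2-0 2026-08-28T07:09:38Z):
its hypotheses are this route's items and its conclusion the sub-problem Statement (glue_lint), and it elaborates with this file. -/

/-- The deciding implication (D-0027 §2.1): the two cruxes (quarter law, no terminal jolt) and the two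
provable-now supports (jolt-flat cell; no flat-cell vertex) decide Clay (A). Pure logic over the frame
result `navierStokesRegularity_of_noBlowup` and the ε-regularity contrapositive
`exists_singularPoint_of_classical_of_not_hasSmoothExtensionPast`. -/
@[closes "route-NavierStokesRegularity-QuarterJolt"] theorem closes (hQ : EnstrophyQuarterLaw) (hJ : NoTerminalJolt) (hF : JoltFlatCell)
    (hV : NoFlatCellVertex) : NavierStokesRegularity := by
  refine Summit.NavierStokesRegularity.NavierStokesRegularity.Theorems.navierStokesRegularity_of_noBlowup ?_
  intro ν T hν hT u p hcl hLH hdec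
  by_contra hext
  obtain ⟨K, hK⟩ := hQ ν T hν hT u p ⟨hcl, hext⟩ hLH hdec
  obtain ⟨x₀, hx₀⟩ :=
    Literature.Analysis.FluidPDE.exists_singularPoint_of_classical_of_not_hasSmoothExtensionPast
      hν hT hcl hLH hdec hext
  have hflat := hF ν T hν hT u p hcl hLH hdec K hK (hJ ν T hν hT u p hcl hLH hdec) x₀
  exact hV ν T hν hT u p hcl hLH hdec K hK x₀ hflat hx₀

end Summit.NavierStokesRegularity.NavierStokesRegularity.Theses.QuarterJolt
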